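import Literature.MathematicalPhysics.KineticTheory.HardSphereTwoTimePressure
import Summits.AtomisticToContinuum.HydrodynamicLimit.Theorems.OneFlightGossipEngineEnergyCurrentTailsDocking
import HarnessLib

/-!
# The exergy influence bound at time `0` (stub 4 of line `IdeatorThreeSketch` / card
# `loschmidt-tagging-exergy` for the crux `EnergyCurrentTails`, stmt-AtomisticToContinuum-9235)

Helper file of the line lead (prover-line-stmt-AtomisticToContinuum-9235-0) for the registered stub
`stub_exergyInfluence_initial` of `Cruxes/EnergyCurrentTails/Lines/IdeatorThreeSketch.lean`: the
`s = 0` instance (typing certificate) of the line's open transfer statement, the EXERGY INFLUENCE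
BOUND.

Let `λ_N = localGibbsLaw σ a₀ u₀ θ₀ N (Φ N)` be the local Gibbs data (continuous profiles `a₀ > 0`,
`θ₀ > 0`, `u₀`) and `G = localGibbsLaw σ 1 0 θr N (Φ N)` the HOMOGENEOUS reference with
`θr = min θ₀`.  For `σ < 1/2` both are probability measures with positive canonical densities on the
hard-sphere domain, so `λ_N = F · G` with the measurable density `F = ρ_λ / ρ_G`.  Tested against a
one-particle velocity observable `g ≥ 0`,
`∫ g(vᵢ) F(flip(Φ_0 z)) dG = ∫ g(vᵢ) F(flip z) dG = ∫ g(-vᵢ) F dG = ∫ g(-vᵢ) dλ_N`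
(`Φ_0 = id` a.e., `flip`-invariance of `G`), and by the disintegration of `λ_N` into positions and
independent Gaussian velocities this is a position average of the one-body integrals
`∫ g(-w) N(u₀(xᵢ), θ₀(xᵢ))(dw)`.  The pointwise Gaussian envelope
`M_{θ₀(x),u₀(x)}(-w) ≤ C e^{β|w|²/2} M_{θr,0}(w)`, `β = 1/θr - 1/(2 max θ₀)` (so `βθr < 1`),
`C = exp(max|u₀|² / (2θr))`, bounds each of them by `C ∫ g(w) e^{β|w|²/2} N(0, θr)(dw)`, which is
the one-body velocity marginal of the right-hand side under `G`
(`lintegral_vel_localGibbsLaw_const`).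

References: H. Spohn, *Large Scale Dynamics of Interacting Particles* (1991) Part I §2.3 (local
equilibrium states); C. Cercignani, R. Illner, M. Pulvirenti, *The Mathematical Theory of Dilute
Gases* (1994) §4.2.
-/

noncomputable section

open MeasureTheory Set Filter
open scoped ENNReal

namespace Summit.AtomisticToContinuum.HydrodynamicLimit.Theorems.LoschmidtTagging

open Literature.MathematicalPhysics.KineticTheory Literature.Analysis.FluidPDE

/-- **Pointwise Gaussian envelope of a reflected drifted Maxwellian.**  If `0 < θmin ≤ θ ≤ θmax`
and `|u| ≤ U`, then for every `w`,
`M_{1,u,θ}(-w) ≤ exp(U²/(2θmin)) · exp(β|w|²/2) · M_{1,0,θmin}(w)` with `β = 1/θmin - 1/(2θmax)`: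
compare the normalising powers (`θ ≥ θmin`, negative exponent) and use
`|w + u|² ≥ |w|²/2 - |u|²`. -/
theorem localMaxwellian_neg_le_exp_mul {θmin θmax θ U : ℝ} (hθmin : 0 < θmin) (hθ1 : θmin ≤ θ)
    (hθ2 : θ ≤ θmax) {u : V3} (hu : ‖u‖ ≤ U) (w : V3) :
    localMaxwellian 1 θ u (-w) ≤
      Real.exp (U ^ 2 / (2 * θmin)) * Real.exp ((1 / θmin - 1 / (2 * θmax)) * ‖w‖ ^ 2 / 2) *
        localMaxwellian 1 θmin (0 : V3) w := by
  have hθ : 0 < θ := hθmin.trans_le hθ1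
  have hθmax : 0 < θmax := hθ.trans_le hθ2
  -- the normalising powers
  have hpow : (2 * Real.pi * θ) ^ (-(Module.finrank ℝ V3 : ℝ) / 2) ≤
      (2 * Real.pi * θmin) ^ (-(Module.finrank ℝ V3 : ℝ) / 2) := by
    refine Real.rpow_le_rpow_of_nonpos (by positivity)
      (mul_le_mul_of_nonneg_left hθ1 (by positivity)) ?_
    have h0 : (0 : ℝ) ≤ (Module.finrank ℝ V3 : ℝ) := Nat.cast_nonneg _
    linarith
  -- the exponents
  have hnorm : ‖w‖ ≤ ‖-w - u‖ + ‖u‖ := by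
    calc ‖w‖ = ‖-w‖ := (norm_neg w).symm
      _ = ‖(-w - u) + u‖ := by rw [sub_add_cancel]
      _ ≤ ‖-w - u‖ + ‖u‖ := norm_add_le _ _
  have hsq : ‖w‖ ^ 2 ≤ 2 * ‖-w - u‖ ^ 2 + 2 * U ^ 2 := by
    have h2 : ‖w‖ ^ 2 ≤ (‖-w - u‖ + ‖u‖) ^ 2 := pow_le_pow_left₀ (norm_nonneg w) hnorm 2
    have h3 : ‖u‖ ^ 2 ≤ U ^ 2 := pow_le_pow_left₀ (norm_nonneg u) hu 2
    nlinarith [h2, h3, sq_nonneg (‖-w - u‖ - ‖u‖)]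
  have hexp : -‖-w - u‖ ^ 2 / (2 * θ) ≤
      U ^ 2 / (2 * θmin) + (1 / θmin - 1 / (2 * θmax)) * ‖w‖ ^ 2 / 2 +
        -‖w‖ ^ 2 / (2 * θmin) := by
    have e1 : -‖-w - u‖ ^ 2 / (2 * θ) ≤ (U ^ 2 - ‖w‖ ^ 2 / 2) / (2 * θ) :=
      div_le_div_of_nonneg_right (by linarith) (by positivity)
    have e2 : U ^ 2 / (2 * θ) ≤ U ^ 2 / (2 * θmin) :=
      div_le_div_of_nonneg_left (sq_nonneg U) (by positivity) (by linarith)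
    have e3 : ‖w‖ ^ 2 / (4 * θmax) ≤ ‖w‖ ^ 2 / (4 * θ) :=
      div_le_div_of_nonneg_left (sq_nonneg _) (by positivity) (by linarith)
    have e4 : (U ^ 2 - ‖w‖ ^ 2 / 2) / (2 * θ) = U ^ 2 / (2 * θ) - ‖w‖ ^ 2 / (4 * θ) := by ring
    have e5 : U ^ 2 / (2 * θmin) + (1 / θmin - 1 / (2 * θmax)) * ‖w‖ ^ 2 / 2 +
        -‖w‖ ^ 2 / (2 * θmin) = U ^ 2 / (2 * θmin) - ‖w‖ ^ 2 / (4 * θmax) := by ring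
    rw [e4] at e1
    rw [e5]
    linarith
  simp only [localMaxwellian, one_mul, sub_zero]
  calc (2 * Real.pi * θ) ^ (-(Module.finrank ℝ V3 : ℝ) / 2) * Real.exp (-‖-w - u‖ ^ 2 / (2 * θ))
      ≤ (2 * Real.pi * θmin) ^ (-(Module.finrank ℝ V3 : ℝ) / 2) *
          Real.exp (U ^ 2 / (2 * θmin) + (1 / θmin - 1 / (2 * θmax)) * ‖w‖ ^ 2 / 2 +
            -‖w‖ ^ 2 / (2 * θmin)) :=
        mul_le_mul hpow (Real.exp_le_exp.2 hexp) (Real.exp_pos _).le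
          (Real.rpow_nonneg (by positivity) _)
    _ = Real.exp (U ^ 2 / (2 * θmin)) * Real.exp ((1 / θmin - 1 / (2 * θmax)) * ‖w‖ ^ 2 / 2) *
          ((2 * Real.pi * θmin) ^ (-(Module.finrank ℝ V3 : ℝ) / 2) *
            Real.exp (-‖w‖ ^ 2 / (2 * θmin))) := by
        rw [Real.exp_add, Real.exp_add]
        ring

/-- **One-body exergy bound.**  If `0 < θmin ≤ θ ≤ θmax` and `|u| ≤ U`, then for every measurable
`g ≥ 0` the reflected Gaussian expectation is dominated by a tilted centred one at the minimal
temperature: `∫ g(-w) N(u, θ)(dw) ≤ exp(U²/(2θmin)) ∫ g(w) e^{β|w|²/2} N(0, θmin)(dw)`,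
`β = 1/θmin - 1/(2θmax)` (both Gaussians as Maxwellian densities, the reflection `w ↦ -w` of
Lebesgue measure, and `localMaxwellian_neg_le_exp_mul`). -/
theorem lintegral_comp_neg_gaussMeasure_le {θmin θmax θ U : ℝ} (hθmin : 0 < θmin)
    (hθ1 : θmin ≤ θ) (hθ2 : θ ≤ θmax) {u : V3} (hu : ‖u‖ ≤ U) {g : V3 → ℝ≥0∞}
    (hg : Measurable g) :
    ∫⁻ w, g (-w) ∂(gaussMeasure u θ) ≤
      ENNReal.ofReal (Real.exp (U ^ 2 / (2 * θmin))) *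
        ∫⁻ w, g w * ENNReal.ofReal (Real.exp ((1 / θmin - 1 / (2 * θmax)) * ‖w‖ ^ 2 / 2))
          ∂(gaussMeasure (0 : V3) θmin) := by
  have hθ : 0 < θ := hθmin.trans_le hθ1
  have hEm : Measurable fun w : V3 =>
      ENNReal.ofReal (Real.exp ((1 / θmin - 1 / (2 * θmax)) * ‖w‖ ^ 2 / 2)) :=
    (((measurable_norm.pow_const 2).const_mul _).div_const 2).exp.ennreal_ofReal
  have hM : Measurable fun v : V3 => ENNReal.ofReal (localMaxwellian 1 θ u v) :=
    (continuous_localMaxwellian 1 θ u).measurable.ennreal_ofReal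
  have hMr : Measurable fun v : V3 => ENNReal.ofReal (localMaxwellian 1 θmin (0 : V3) v) :=
    (continuous_localMaxwellian 1 θmin (0 : V3)).measurable.ennreal_ofReal
  have hgn : Measurable fun w : V3 => g (-w) := hg.comp measurable_neg
  have hgE : Measurable fun w : V3 =>
      g w * ENNReal.ofReal (Real.exp ((1 / θmin - 1 / (2 * θmax)) * ‖w‖ ^ 2 / 2)) := hg.mul hEm
  have hMgE : Measurable fun w : V3 => ENNReal.ofReal (localMaxwellian 1 θmin (0 : V3) w) *
      (g w * ENNReal.ofReal (Real.exp ((1 / θmin - 1 / (2 * θmax)) * ‖w‖ ^ 2 / 2))) :=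
    hMr.mul hgE
  calc ∫⁻ w, g (-w) ∂(gaussMeasure u θ)
      = ∫⁻ w, ENNReal.ofReal (localMaxwellian 1 θ u w) * g (-w) := by
        rw [← withDensity_localMaxwellian_eq_gaussMeasure hθ u,
          lintegral_withDensity_eq_lintegral_mul _ hM hgn]
        rfl
    _ = ∫⁻ w, ENNReal.ofReal (localMaxwellian 1 θ u (-w)) * g w := by
        rw [← lintegral_neg_eq_self (μ := (volume : Measure V3))
          (fun w => ENNReal.ofReal (localMaxwellian 1 θ u (-w)) * g w)]
        simp only [neg_neg]
    _ ≤ ∫⁻ w, ENNReal.ofReal (Real.exp (U ^ 2 / (2 * θmin))) *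
          (ENNReal.ofReal (localMaxwellian 1 θmin (0 : V3) w) *
            (g w * ENNReal.ofReal (Real.exp ((1 / θmin - 1 / (2 * θmax)) * ‖w‖ ^ 2 / 2)))) := by
        refine lintegral_mono fun w => ?_
        calc ENNReal.ofReal (localMaxwellian 1 θ u (-w)) * g w
            ≤ ENNReal.ofReal (Real.exp (U ^ 2 / (2 * θmin)) *
                Real.exp ((1 / θmin - 1 / (2 * θmax)) * ‖w‖ ^ 2 / 2) *
                  localMaxwellian 1 θmin (0 : V3) w) * g w :=
              mul_le_mul_left (ENNReal.ofReal_le_ofReal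
                (localMaxwellian_neg_le_exp_mul hθmin hθ1 hθ2 hu w)) _
          _ = _ := by
              rw [ENNReal.ofReal_mul (by positivity), ENNReal.ofReal_mul (by positivity)]
              ring
    _ = ENNReal.ofReal (Real.exp (U ^ 2 / (2 * θmin))) *
          ∫⁻ w, ENNReal.ofReal (localMaxwellian 1 θmin (0 : V3) w) *
            (g w * ENNReal.ofReal (Real.exp ((1 / θmin - 1 / (2 * θmax)) * ‖w‖ ^ 2 / 2))) :=
        lintegral_const_mul _ hMgE
    _ = _ := by
        rw [← withDensity_localMaxwellian_eq_gaussMeasure hθmin (0 : V3),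
          lintegral_withDensity_eq_lintegral_mul _ hMr hgE]
        rfl

/-- **The exergy influence bound at time `0`** (registered stub `stub_exergyInfluence_initial` of
line `IdeatorThreeSketch`, crux stmt-AtomisticToContinuum-9235; the `s = 0` instance of the line's
open transfer statement).  For continuous profiles `a₀, θ₀ > 0`, `u₀` and `σ < σ₀ := 1/2`: with
`a = 1`, `θr = min θ₀`, `β = 1/θr - 1/(2 max θ₀)` (`βθr < 1`), `C = exp(max|u₀|²/(2θr))`, `N₀ = 0`,
the local Gibbs data has the measurable density `F = ρ_λ/ρ_G` with respect to the homogeneous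
reference `G = localGibbsLaw σ 1 0 θr`, and for every particle `i` and measurable `g ≥ 0`,
`∫ g(vᵢ) F(flip(Φ_0 z)) dG ≤ C ∫ g(vᵢ) e^{β|vᵢ|²/2} dG` (`Φ_0 = id` a.e., `flip`-invariance of `G`,
disintegration `lintegral_localGibbsMeasure`, the one-body bound
`lintegral_comp_neg_gaussMeasure_le`, and `lintegral_vel_localGibbsLaw_const`). -/
theorem stub_exergyInfluence_initial :
    ∀ (a₀ θ₀ : T3 → ℝ) (u₀ : T3 → V3), Continuous a₀ → Continuous θ₀ → Continuous u₀ →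
      (∀ x, 0 < a₀ x) → (∀ x, 0 < θ₀ x) →
      ∃ σ₀ : ℝ, 0 < σ₀ ∧ ∀ σ : ℝ, 0 < σ → σ < σ₀ →
        ∀ Φ : (N : ℕ) → HardSphereFlow (Torus.geometry (Fin 3)) (hsDiameter σ N) (N + 1),
          ∃ a θr β C : ℝ, 0 < a ∧ 0 < θr ∧ β * θr < 1 ∧ 0 ≤ C ∧
            ∃ N₀ : ℕ, ∀ N : ℕ, N₀ ≤ N →
              ∃ F : Config (N + 1) (Fin 3) T3 → ℝ≥0∞, Measurable F ∧
                localGibbsLaw σ a₀ u₀ θ₀ N (Φ N)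
                  = (localGibbsLaw σ (fun _ => a) (fun _ => 0) (fun _ => θr) N (Φ N)).withDensity F ∧
                ∀ (i : Fin (N + 1)) (g : V3 → ℝ≥0∞), Measurable g →
                  ∫⁻ z, g ((z i).2) * F (flipVel ((Φ N).flow 0 z))
                      ∂(localGibbsLaw σ (fun _ => a) (fun _ => 0) (fun _ => θr) N (Φ N))
                    ≤ ENNReal.ofReal C *
                      ∫⁻ z, g ((z i).2) * ENNReal.ofReal (Real.exp (β * ‖(z i).2‖ ^ 2 / 2))
                        ∂(localGibbsLaw σ (fun _ => a) (fun _ => 0) (fun _ => θr) N (Φ N)) := by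
  intro a₀ θ₀ u₀ ha hθ hu ha0 hθ0
  have ha0' : ∀ x, 0 ≤ a₀ x := fun x => (ha0 x).le
  -- extrema of the continuous profiles on the compact torus
  obtain ⟨xm, -, hxm⟩ := isCompact_univ.exists_isMinOn univ_nonempty hθ.continuousOn
  obtain ⟨xM, -, hxM⟩ := isCompact_univ.exists_isMaxOn univ_nonempty hθ.continuousOn
  obtain ⟨U, hU⟩ : ∃ U : ℝ, ∀ x, ‖u₀ x‖ ≤ U := by
    obtain ⟨C, hC⟩ := isCompact_univ.exists_bound_of_continuousOn hu.continuousOn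
    exact ⟨C, fun x => hC x (mem_univ x)⟩
  have hmin : ∀ y, θ₀ xm ≤ θ₀ y := fun y => hxm (mem_univ y)
  have hmax : ∀ y, θ₀ y ≤ θ₀ xM := fun y => hxM (mem_univ y)
  have hθmin : 0 < θ₀ xm := hθ0 xm
  have hθmax : 0 < θ₀ xM := hθ0 xM
  refine ⟨1 / 2, by norm_num, ?_⟩
  intro σ hσ hσlt Φ
  have hσ2 : σ ≤ 1 / 2 := hσlt.le
  refine ⟨1, θ₀ xm, 1 / θ₀ xm - 1 / (2 * θ₀ xM), Real.exp (U ^ 2 / (2 * θ₀ xm)), one_pos, hθmin,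
    ?_, (Real.exp_pos _).le, 0, fun N _ => ?_⟩
  · -- `β θr = 1 - θmin / (2 θmax) < 1`
    have h1 : (1 / θ₀ xm - 1 / (2 * θ₀ xM)) * θ₀ xm = 1 - θ₀ xm / (2 * θ₀ xM) := by
      field_simp
    rw [h1]
    have h2 : 0 < θ₀ xm / (2 * θ₀ xM) := by positivity
    linarith
  -- the two canonical densities
  set ρD : Config (N + 1) (Fin 3) T3 → ℝ := canonicalDensity (Torus.geometry (Fin 3))
    (hsDiameter σ N) (N + 1) (localGibbsProfile a₀ u₀ θ₀) with hρD
  set ρR : Config (N + 1) (Fin 3) T3 → ℝ := canonicalDensity (Torus.geometry (Fin 3))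
    (hsDiameter σ N) (N + 1)
      (localGibbsProfile (fun _ => (1 : ℝ)) (fun _ => (0 : V3)) (fun _ => θ₀ xm)) with hρR
  have hρDm : Measurable ρD :=
    measurable_canonicalDensity _ _ (measurable_localGibbsProfile ha hθ hu)
  have hρRm : Measurable ρR :=
    measurable_canonicalDensity _ _
      (measurable_localGibbsProfile continuous_const continuous_const continuous_const)
  -- the reference density is positive on the hard-sphere domain
  have hZG : 0 < canonicalPartition (Torus.geometry (Fin 3)) (hsDiameter σ N) (N + 1)
      (localGibbsProfile (fun _ => (1 : ℝ)) (fun _ => (0 : V3)) (fun _ => θ₀ xm)) := by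
    rw [canonicalPartition_eq_posPartition continuous_const continuous_const continuous_const
      (fun _ => zero_le_one) (fun _ => hθmin)]
    exact posPartition_pos continuous_const (fun _ => one_pos) hσ2 N
  have hρR_pos : ∀ z ∈ hardSphereDomain (Torus.geometry (Fin 3)) (N + 1) (hsDiameter σ N),
      0 < ρR z := by
    intro z hz
    have hprod : 0 < tensorPow (N + 1)
        (localGibbsProfile (fun _ => (1 : ℝ)) (fun _ => (0 : V3)) (fun _ => θ₀ xm)) z := by
      unfold tensorPow localGibbsProfile
      exact Finset.prod_pos fun j _ => mul_pos one_pos (localMaxwellian_pos one_pos hθmin _ _)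
    simp only [hρR, canonicalDensity, Set.indicator_of_mem hz]
    exact mul_pos (inv_pos.2 hZG) hprod
  -- the density `F = ρD / ρR`
  set F : Config (N + 1) (Fin 3) T3 → ℝ≥0∞ := fun z => ENNReal.ofReal (ρD z / ρR z) with hF
  have hFm : Measurable F := (hρDm.div hρRm).ennreal_ofReal
  have hprod_eq : ((fun z => ENNReal.ofReal (ρR z)) * F) = fun z => ENNReal.ofReal (ρD z) := by
    funext z
    simp only [Pi.mul_apply, hF]
    by_cases hz : z ∈ hardSphereDomain (Torus.geometry (Fin 3)) (N + 1) (hsDiameter σ N)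
    · have hpos := hρR_pos z hz
      rw [← ENNReal.ofReal_mul hpos.le, mul_div_cancel₀ _ hpos.ne']
    · have h1 : ρD z = 0 := canonicalDensity_eq_zero_of_notMem _ _ _ _ hz
      have h2 : ρR z = 0 := canonicalDensity_eq_zero_of_notMem _ _ _ _ hz
      rw [h1, h2, ENNReal.ofReal_zero, zero_mul]
  have hlaw : localGibbsLaw σ a₀ u₀ θ₀ N (Φ N) =
      (localGibbsLaw σ (fun _ => 1) (fun _ => 0) (fun _ => θ₀ xm) N (Φ N)).withDensity F := by
    rw [localGibbsLaw_eq, localGibbsLaw_eq]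
    change volume.withDensity (fun z => ENNReal.ofReal (ρD z)) =
      (volume.withDensity (fun z => ENNReal.ofReal (ρR z))).withDensity F
    rw [← withDensity_mul _ hρRm.ennreal_ofReal hFm, hprod_eq]
  refine ⟨F, hFm, hlaw, fun i g hg => ?_⟩
  -- the tested inequality
  haveI := isProbabilityMeasure_localGibbsMeasure ha hθ hu ha0 hθ0 hσ2 N
  have hSe := measurableEmbedding_flipVel (X := T3) (d := Fin 3) (N := N + 1)
  have hR := measurePreserving_flipVel_localGibbsLaw σ (fun _ => (1 : ℝ)) (fun _ => θ₀ xm) N (Φ N)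
  have hgn : Measurable fun w : Config (N + 1) (Fin 3) T3 => g (-(w i).2) :=
    hg.comp (measurable_pi_apply i).snd.neg
  have hgneg : Measurable fun w : V3 => g (-w) := hg.comp measurable_neg
  have hEm : Measurable fun w : V3 =>
      ENNReal.ofReal (Real.exp ((1 / θ₀ xm - 1 / (2 * θ₀ xM)) * ‖w‖ ^ 2 / 2)) :=
    (((measurable_norm.pow_const 2).const_mul _).div_const 2).exp.ennreal_ofReal
  have hgE : Measurable fun w : V3 =>
      g w * ENNReal.ofReal (Real.exp ((1 / θ₀ xm - 1 / (2 * θ₀ xM)) * ‖w‖ ^ 2 / 2)) := hg.mul hEm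
  have hZm : Measurable fun x : Fin (N + 1) → T3 => ENNReal.ofReal
      ((canonicalPartition (Torus.geometry (Fin 3)) (hsDiameter σ N) (N + 1)
        (localGibbsProfile a₀ u₀ θ₀))⁻¹ * posWeight a₀ (hsDiameter σ N) (N + 1) x) :=
    ((measurable_posWeight ha _ _).const_mul _).ennreal_ofReal
  -- the one-body inner bound, uniformly in the positions
  have hinner : ∀ x : Fin (N + 1) → T3,
      ∫⁻ v, g (-(v i)) ∂velMeasure u₀ θ₀ x ≤
        ENNReal.ofReal (Real.exp (U ^ 2 / (2 * θ₀ xm))) *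
          ∫⁻ w, g w * ENNReal.ofReal (Real.exp ((1 / θ₀ xm - 1 / (2 * θ₀ xM)) * ‖w‖ ^ 2 / 2))
            ∂(gaussMeasure (0 : V3) (θ₀ xm)) := by
    intro x
    have hmp : MeasurePreserving (Function.eval i) (velMeasure u₀ θ₀ x)
        (gaussMeasure (u₀ (x i)) (θ₀ (x i))) := by
      unfold velMeasure
      exact measurePreserving_eval _ i
    calc ∫⁻ v, g (-(v i)) ∂velMeasure u₀ θ₀ x
        = ∫⁻ w, g (-w) ∂(gaussMeasure (u₀ (x i)) (θ₀ (x i))) := hmp.lintegral_comp hgneg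
      _ ≤ _ := lintegral_comp_neg_gaussMeasure_le hθmin (hmin (x i)) (hmax (x i)) (hU (x i)) hg
  calc ∫⁻ z, g ((z i).2) * F (flipVel ((Φ N).flow 0 z))
        ∂(localGibbsLaw σ (fun _ => 1) (fun _ => 0) (fun _ => θ₀ xm) N (Φ N))
      = ∫⁻ z, g ((z i).2) * F (flipVel z)
          ∂(localGibbsLaw σ (fun _ => 1) (fun _ => 0) (fun _ => θ₀ xm) N (Φ N)) := by
        refine lintegral_congr_ae ?_
        filter_upwards [ae_mem_good_localGibbsLaw σ (fun _ => (1 : ℝ)) (fun _ => (0 : V3))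
          (fun _ => θ₀ xm) N (Φ N)] with z hz
        rw [(Φ N).flow_zero z hz]
    _ = ∫⁻ z, (fun w => F w * g (-(w i).2)) (flipVel z)
          ∂(localGibbsLaw σ (fun _ => 1) (fun _ => 0) (fun _ => θ₀ xm) N (Φ N)) := by
        refine lintegral_congr fun z => ?_
        show g ((z i).2) * F (flipVel z) = F (flipVel z) * g (-(-(z i).2))
        rw [neg_neg, mul_comm]
    _ = ∫⁻ w, F w * g (-(w i).2)
          ∂(localGibbsLaw σ (fun _ => 1) (fun _ => 0) (fun _ => θ₀ xm) N (Φ N)) :=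
        hR.lintegral_comp_emb hSe (fun w => F w * g (-(w i).2))
    _ = ∫⁻ w, g (-(w i).2)
          ∂((localGibbsLaw σ (fun _ => 1) (fun _ => 0) (fun _ => θ₀ xm) N (Φ N)).withDensity F) :=
        by
        rw [lintegral_withDensity_eq_lintegral_mul _ hFm hgn]
        rfl
    _ = ∫⁻ w, g (-(w i).2) ∂(localGibbsMeasure σ a₀ u₀ θ₀ N) := by
        rw [← hlaw, localGibbsLaw_eq]
    _ = ∫⁻ x, ENNReal.ofReal ((canonicalPartition (Torus.geometry (Fin 3)) (hsDiameter σ N) (N + 1)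
            (localGibbsProfile a₀ u₀ θ₀))⁻¹ * posWeight a₀ (hsDiameter σ N) (N + 1) x) *
          ∫⁻ v, g (-(v i)) ∂velMeasure u₀ θ₀ x := by
        have h := lintegral_localGibbsMeasure ha hθ hu ha0' hθ0 σ N hgn
        simpa only [zipConfig_apply] using h
    _ ≤ ∫⁻ x, ENNReal.ofReal ((canonicalPartition (Torus.geometry (Fin 3)) (hsDiameter σ N) (N + 1)
            (localGibbsProfile a₀ u₀ θ₀))⁻¹ * posWeight a₀ (hsDiameter σ N) (N + 1) x) *
          (ENNReal.ofReal (Real.exp (U ^ 2 / (2 * θ₀ xm))) *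
            ∫⁻ w, g w * ENNReal.ofReal (Real.exp ((1 / θ₀ xm - 1 / (2 * θ₀ xM)) * ‖w‖ ^ 2 / 2))
              ∂(gaussMeasure (0 : V3) (θ₀ xm))) :=
        lintegral_mono fun x => mul_le_mul_right (hinner x) _
    _ = ENNReal.ofReal (Real.exp (U ^ 2 / (2 * θ₀ xm))) *
          ∫⁻ w, g w * ENNReal.ofReal (Real.exp ((1 / θ₀ xm - 1 / (2 * θ₀ xM)) * ‖w‖ ^ 2 / 2))
            ∂(gaussMeasure (0 : V3) (θ₀ xm)) := by
        rw [lintegral_mul_const _ hZm, lintegral_posWeight_eq_one ha hθ hu ha0' hθ0 σ N, one_mul]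
    _ = ENNReal.ofReal (Real.exp (U ^ 2 / (2 * θ₀ xm))) *
          ∫⁻ z, g ((z i).2) *
              ENNReal.ofReal (Real.exp ((1 / θ₀ xm - 1 / (2 * θ₀ xM)) * ‖(z i).2‖ ^ 2 / 2))
            ∂(localGibbsLaw σ (fun _ => 1) (fun _ => 0) (fun _ => θ₀ xm) N (Φ N)) := by
        rw [lintegral_vel_localGibbsLaw_const hσ2 one_pos hθmin N (Φ N) i hgE]

end Summit.AtomisticToContinuum.HydrodynamicLimit.Theorems.LoschmidtTagging

end
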